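import Summits.NavierStokesRegularity.NavierStokesRegularity.Theses.FlatSwirlGauge
import Summits.NavierStokesRegularity.NavierStokesRegularity.Theorems.Target.Negative.EnergyClassLoadBearing

/-!
# Crux `CriticalSwirlRegularity` (stmt-NavierStokesRegularity-1253), negative side:
# the finite-energy (Leray–Hopf) clause is load-bearing — the flat swirl gauge alone excludes nothing

Negative-side (dossier) support file for the crux `CriticalSwirlRegularity` (CSR) of route `FlatSwirlGauge`
(NavierStokesRegularity), written by the line lead (continuation c7) of the dead line `registered`, next to the
rest-state witnesses of leads c1–c3 and the hardness sandwich of c4 in this directory. The crux: a classical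
solution `(u, p)` of unforced Navier–Stokes on `ℝ³ × [0, T)` (`ν > 0`), Leray–Hopf on `[0, T]` from the rapidly
decaying datum `u 0`, which admits a FLAT SWIRL GAUGE `(ρ, C₀, M, α, b, d)` on a backward cylinder `Q_ρ(T, x₀)`
(bounded `C²` momentum `α`, `ω·∇α = 0`, chart nondegeneracy `‖ω‖ d ≤ C₀‖∇α‖`, flat transport
`(∂ₜ + u·∇)α = ν(Δα + ⟪b, ∇α⟫)` with `‖b‖ d ≤ C₀` where `d > 0`, typed thinness `vol({d < δ} ∩ B_ρ(x₀)) ≤ C₀δ²ρ`),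
is bounded on some `(T − r², T) × B_r(x₀)`.

This file records the first disproof-side certificate of the crux (there is no `Cruxes/CriticalSwirlRegularity/
Disproof.lean`): WHICH antecedent any proof must use.

* `curl_const`, `driftVel_trivialFlatGauge` — an irrotational flow carries the TRIVIAL flat swirl gauge `α ≡ 0`,
  `b ≡ 0`, `d ≡ 1`, `C₀ = M = 0` on every backward cylinder (all vorticity clauses read `0 ≤ 0`, the degeneracy
  set is empty); in particular the KNSS parasitic drift flow `u(t, x) = −log(1 − t) e₀`, `p = −x₀/(1 − t)`
  (Koch–Nadirashvili–Seregin–Šverák 2009, §1 p. 3; in-tree `Target.Negative.driftVel`, a classical solution on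
  `[0, 1)` from REST, `isClassical_drift`) does, at every vertex `x₀`.
* `driftVel_not_bounded_near` — the drift flow is unbounded on every backward cylinder at `T = 1`
  (`‖u(t, ·)‖ = −log(1 − t) → ∞`).
* `criticalSwirlRegularity_false_without_isLerayHopfOn` — with the clause `IsLerayHopfOn T ν 0 (u 0) u` DELETED
  (classical solution, rapidly decaying datum and flat gauge kept) the crux is FALSE.
* `criticalSwirlRegularity_false_without_energy` — keeping of the Leray–Hopf bundle only its first field, the
  pressure-free weak formulation `IsWeakNSSolutionOn` (in-tree `isWeakNSSolutionOn_drift`: compactly supported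
  solenoidal tests have zero mean), the statement is still FALSE: exactly the finite-energy clauses
  (`u(t) ∈ L²`, the energy inequality) are load-bearing.
* `flatGaugeExcludesTypeI_false_without_isLerayHopfOn` — the same witness obeys the Type-I rate
  (`isTypeIBlowup_drift`), so the sibling crux `FlatGaugeExcludesTypeI` (stmt-NavierStokesRegularity-1254) has
  the same load-bearing clause.
* `not_isLerayHopfOn_driftVel_of_criticalSwirlRegularity` — sanity: the crux, by name, implies that the drift
  flow is not Leray–Hopf from rest.

Reading for planners / ideators: the v0 gauge block + classical NS + Schwartz datum (+ Type I) carry NO local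
boundedness information whatsoever; every line for CSR must route the finite-energy class into the argument
(energy inequality / CKN ε-regularity currency). A line whose stubs reason only with the maximum principle for
`α`, the chart clause and the local equations cannot close the crux. Nothing here closes the item (`--supports`);
nothing here is new mathematics.

## References

* G. Koch, N. Nadirashvili, G. Seregin, V. Šverák, *Liouville theorems for the Navier–Stokes equations and
  applications*, Acta Math. 203 (2009) 83–105, §1 p. 3 (parasitic solutions `u = b(t)`, `p = −b′(t)·x`).
  [KNSS2009]
-/

noncomputable section

open MeasureTheory Set Function Filter Metric
open scoped Topology RealInnerProductSpace InnerProductSpace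
open Literature.Analysis.FluidPDE
open Summit.NavierStokesRegularity.NavierStokesRegularity.Theorems.Target.Negative

namespace Summit.NavierStokesRegularity.NavierStokesRegularity.Theorems.CriticalSwirlRegularity.Negative

/-! ### Irrotational flows carry the trivial flat swirl gauge -/

/-- A constant vector field on `(EuclideanSpace ℝ (Fin 3))` is irrotational: `curl (fun _ ↦ c) = 0` (its Fréchet derivative vanishes;
Majda–Bertozzi §1.1). [folklore] -/
theorem curl_const (c x : (EuclideanSpace ℝ (Fin 3))) : curl (fun _ : (EuclideanSpace ℝ (Fin 3)) => c) x = 0 := by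
  ext i
  fin_cases i <;> simp [curl]

/-- **The drift flow carries the trivial flat swirl gauge at every vertex.** For the spatially uniform drift flow
`u(t, x) = −log(1 − t) e₀` (`Target.Negative.driftVel`), every viscosity `ν` and every `x₀ ∈ (EuclideanSpace ℝ (Fin 3))`, the data
`ρ = 1/2`, `C₀ = 0`, `M = 0`, `α ≡ 0`, `b ≡ 0`, `d ≡ 1` satisfy the v0 flat-swirl-gauge block of the route
`FlatSwirlGauge` on `Q_{1/2}(1, x₀)` verbatim: `α` is `C²` and bounded by `0`, the degeneracy sets `{d < δ}`,
`δ < 1/2`, are empty, `curl u = 0` makes both vorticity clauses `0 ≤ 0`, and the transport law reads `0 = ν · 0`.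
[folklore] -/
theorem driftVel_trivialFlatGauge (ν : ℝ) (x₀ : (EuclideanSpace ℝ (Fin 3))) :
    ∃ (ρ C₀ M : ℝ) (α : ℝ → (EuclideanSpace ℝ (Fin 3)) → ℝ) (b : ℝ → (EuclideanSpace ℝ (Fin 3)) → (EuclideanSpace ℝ (Fin 3))) (d : ℝ → (EuclideanSpace ℝ (Fin 3)) → ℝ),
      0 < ρ ∧ ρ ^ 2 < 1 ∧
        ContDiffOn ℝ 2 (Function.uncurry α) (Set.Ioo (1 - ρ ^ 2) 1 ×ˢ Metric.ball x₀ ρ) ∧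
        (∀ t ∈ Set.Ioo (1 - ρ ^ 2) 1, ∀ δ ∈ Set.Ioo 0 ρ,
          MeasureTheory.volume ({x | d t x < δ} ∩ Metric.ball x₀ ρ) ≤ ENNReal.ofReal (C₀ * δ ^ 2 * ρ)) ∧
        (∀ t ∈ Set.Ioo (1 - ρ ^ 2) 1, ∀ x ∈ Metric.ball x₀ ρ, |α t x| ≤ M ∧
          inner ℝ (curl (driftVel t) x) (gradient (α t) x) = 0 ∧
          (0 < d t x →
            ‖curl (driftVel t) x‖ * d t x ≤ C₀ * ‖gradient (α t) x‖ ∧ ‖b t x‖ * d t x ≤ C₀ ∧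
              deriv (fun s => α s x) t + convect (driftVel t) (α t) x =
                ν * (Laplacian.laplacian (α t) x + inner ℝ (b t x) (gradient (α t) x)))) := by
  refine ⟨1 / 2, 0, 0, fun _ _ => 0, fun _ _ => 0, fun _ _ => 1, by norm_num, by norm_num, ?_, ?_, ?_⟩
  · -- `α ≡ 0` is smooth
    exact contDiffOn_const
  · -- the degeneracy sets `{1 < δ}`, `δ < 1/2`, are empty
    intro t _ δ hδ
    have hempty : {x : (EuclideanSpace ℝ (Fin 3)) | (1 : ℝ) < δ} ∩ Metric.ball x₀ (1 / 2) = ∅ := by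
      ext x
      simp only [Set.mem_inter_iff, Set.mem_setOf_eq, Set.mem_empty_iff_false, iff_false, not_and]
      intro h
      exact absurd h (by linarith [hδ.2])
    rw [hempty, measure_empty]
    exact bot_le
  · intro t _ x _
    have hcurl : curl (driftVel t) x = 0 := curl_const (driftAmp t • e₀) x
    have hgrad : gradient (fun _ : (EuclideanSpace ℝ (Fin 3)) => (0 : ℝ)) x = 0 := gradient_fun_const x 0
    have hlap : Laplacian.laplacian (fun _ : (EuclideanSpace ℝ (Fin 3)) => (0 : ℝ)) x = 0 := by
      rw [InnerProductSpace.laplacian_const]; rfl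
    refine ⟨by simp, by simp [hgrad], fun _ => ⟨by simp [hcurl], by simp, ?_⟩⟩
    simp [hlap]

/-! ### The drift flow blows up at every vertex -/

/-- **The drift flow is unbounded on every backward cylinder at `T = 1`.** For every `x₀` there are no `r > 0`,
`K` with `‖u(t, x)‖ ≤ K` on `(1 − r², 1) × B_r(x₀)` (times `t ≥ 0`): `‖u(t, x₀)‖ = |−log(1 − t)| → ∞` as `t ↑ 1`
(in-tree `tendsto_driftAmp_atTop`). [folklore] -/
theorem driftVel_not_bounded_near (x₀ : (EuclideanSpace ℝ (Fin 3))) :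
    ¬ (∃ r : ℝ, 0 < r ∧ ∃ K : ℝ, ∀ t ∈ Set.Ioo (1 - r ^ 2) 1, 0 ≤ t →
      ∀ x ∈ Metric.ball x₀ r, ‖driftVel t x‖ ≤ K) := by
  rintro ⟨r, hr, K, hK⟩
  have h1 : ∀ᶠ t in 𝓝[<] (1 : ℝ), K < driftAmp t :=
    tendsto_driftAmp_atTop.eventually (eventually_gt_atTop K)
  have h2 : ∀ᶠ t in 𝓝[<] (1 : ℝ), t ∈ Set.Ioo (max (1 - r ^ 2) 0) 1 :=
    Ioo_mem_nhdsLT (max_lt (by nlinarith) one_pos)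
  obtain ⟨t, htK, ht⟩ := (h1.and h2).exists
  have ht' : t ∈ Set.Ioo (1 - r ^ 2) 1 := ⟨(le_max_left _ _).trans_lt ht.1, ht.2⟩
  have ht0 : 0 ≤ t := ((le_max_right _ _).trans_lt ht.1).le
  have h := hK t ht' ht0 x₀ (Metric.mem_ball_self hr)
  have hn : ‖driftVel t x₀‖ = |driftAmp t| := by
    simp [driftVel, norm_smul]
  rw [hn] at h
  linarith [le_abs_self (driftAmp t)]

/-! ### The certificates: which antecedent any proof of the crux must use -/

/-- **Any proof of `CriticalSwirlRegularity` must use the Leray–Hopf clause.** With `IsLerayHopfOn T ν 0 (u 0) u`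
DELETED from the crux (classical solution on `[0, T)`, rapidly decaying datum and the flat swirl gauge kept
verbatim) the statement is FALSE: `ν = 1`, `T = 1`, the drift flow `u = −log(1 − t) e₀` from rest with its
linear pressure (KNSS 2009 §1 p. 3), the vertex `x₀ = 0` and the trivial gauge of `driftVel_trivialFlatGauge`.
Classification if it were the crux: refuted-misstated (missing finite-energy normalisation); the crux itself
carries the clause, so this is a design constraint for lines, not a refutation. [folklore] -/
theorem criticalSwirlRegularity_false_without_isLerayHopfOn :
    ¬ (∀ (ν T : ℝ), 0 < ν → 0 < T → ∀ (u : ℝ → (EuclideanSpace ℝ (Fin 3)) → (EuclideanSpace ℝ (Fin 3))) (p : ℝ → (EuclideanSpace ℝ (Fin 3)) → ℝ),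
      IsClassicalNSSolutionOn (Set.Ico 0 T) ν 0 u p → HasRapidSpatialDecay (u 0) →
      ∀ x₀ : (EuclideanSpace ℝ (Fin 3)),
        (∃ (ρ C₀ M : ℝ) (α : ℝ → (EuclideanSpace ℝ (Fin 3)) → ℝ) (b : ℝ → (EuclideanSpace ℝ (Fin 3)) → (EuclideanSpace ℝ (Fin 3))) (d : ℝ → (EuclideanSpace ℝ (Fin 3)) → ℝ),
          0 < ρ ∧ ρ ^ 2 < T ∧
            ContDiffOn ℝ 2 (Function.uncurry α) (Set.Ioo (T - ρ ^ 2) T ×ˢ Metric.ball x₀ ρ) ∧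
            (∀ t ∈ Set.Ioo (T - ρ ^ 2) T, ∀ δ ∈ Set.Ioo 0 ρ,
              MeasureTheory.volume ({x | d t x < δ} ∩ Metric.ball x₀ ρ) ≤
                ENNReal.ofReal (C₀ * δ ^ 2 * ρ)) ∧
            (∀ t ∈ Set.Ioo (T - ρ ^ 2) T, ∀ x ∈ Metric.ball x₀ ρ, |α t x| ≤ M ∧
              inner ℝ (curl (u t) x) (gradient (α t) x) = 0 ∧
              (0 < d t x →
                ‖curl (u t) x‖ * d t x ≤ C₀ * ‖gradient (α t) x‖ ∧ ‖b t x‖ * d t x ≤ C₀ ∧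
                  deriv (fun s => α s x) t + convect (u t) (α t) x =
                    ν * (Laplacian.laplacian (α t) x + inner ℝ (b t x) (gradient (α t) x))))) →
        ∃ r : ℝ, 0 < r ∧ ∃ K : ℝ, ∀ t ∈ Set.Ioo (T - r ^ 2) T, 0 ≤ t →
          ∀ x ∈ Metric.ball x₀ r, ‖u t x‖ ≤ K) := fun h =>
  driftVel_not_bounded_near 0
    (h 1 1 one_pos one_pos driftVel driftPres (isClassical_drift 1)
      (by rw [driftVel_zero]; exact hasRapidSpatialDecay_zero) 0 (driftVel_trivialFlatGauge 1 0))

/-- **Of the Leray–Hopf bundle only the finite-energy clauses are load-bearing.** Keeping the pressure-free weak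
formulation `IsWeakNSSolutionOn T ν 0 (u 0) u` (the first field of `IsLerayHopfOn`; the drift flow satisfies it,
in-tree `isWeakNSSolutionOn_drift`) but deleting `u(t) ∈ L²`, the energy inequality and the rest of the bundle,
`CriticalSwirlRegularity` is still FALSE (same witness). [folklore] -/
theorem criticalSwirlRegularity_false_without_energy :
    ¬ (∀ (ν T : ℝ), 0 < ν → 0 < T → ∀ (u : ℝ → (EuclideanSpace ℝ (Fin 3)) → (EuclideanSpace ℝ (Fin 3))) (p : ℝ → (EuclideanSpace ℝ (Fin 3)) → ℝ),
      IsClassicalNSSolutionOn (Set.Ico 0 T) ν 0 u p → IsWeakNSSolutionOn T ν 0 (u 0) u →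
      HasRapidSpatialDecay (u 0) →
      ∀ x₀ : (EuclideanSpace ℝ (Fin 3)),
        (∃ (ρ C₀ M : ℝ) (α : ℝ → (EuclideanSpace ℝ (Fin 3)) → ℝ) (b : ℝ → (EuclideanSpace ℝ (Fin 3)) → (EuclideanSpace ℝ (Fin 3))) (d : ℝ → (EuclideanSpace ℝ (Fin 3)) → ℝ),
          0 < ρ ∧ ρ ^ 2 < T ∧
            ContDiffOn ℝ 2 (Function.uncurry α) (Set.Ioo (T - ρ ^ 2) T ×ˢ Metric.ball x₀ ρ) ∧
            (∀ t ∈ Set.Ioo (T - ρ ^ 2) T, ∀ δ ∈ Set.Ioo 0 ρ,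
              MeasureTheory.volume ({x | d t x < δ} ∩ Metric.ball x₀ ρ) ≤
                ENNReal.ofReal (C₀ * δ ^ 2 * ρ)) ∧
            (∀ t ∈ Set.Ioo (T - ρ ^ 2) T, ∀ x ∈ Metric.ball x₀ ρ, |α t x| ≤ M ∧
              inner ℝ (curl (u t) x) (gradient (α t) x) = 0 ∧
              (0 < d t x →
                ‖curl (u t) x‖ * d t x ≤ C₀ * ‖gradient (α t) x‖ ∧ ‖b t x‖ * d t x ≤ C₀ ∧
                  deriv (fun s => α s x) t + convect (u t) (α t) x =
                    ν * (Laplacian.laplacian (α t) x + inner ℝ (b t x) (gradient (α t) x))))) →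
        ∃ r : ℝ, 0 < r ∧ ∃ K : ℝ, ∀ t ∈ Set.Ioo (T - r ^ 2) T, 0 ≤ t →
          ∀ x ∈ Metric.ball x₀ r, ‖u t x‖ ≤ K) := fun h =>
  driftVel_not_bounded_near 0
    (h 1 1 one_pos one_pos driftVel driftPres (isClassical_drift 1) (isWeakNSSolutionOn_drift 1)
      (by rw [driftVel_zero]; exact hasRapidSpatialDecay_zero) 0 (driftVel_trivialFlatGauge 1 0))

/-- **The sibling crux `FlatGaugeExcludesTypeI` (stmt-NavierStokesRegularity-1254) has the same load-bearing
clause.** Adding the Type-I rate `IsTypeIBlowup u T` does not help: the drift flow obeys it with constant `2`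
(in-tree `isTypeIBlowup_drift`), so with `IsLerayHopfOn T ν 0 (u 0) u` deleted that crux is FALSE as well.
[folklore] -/
theorem flatGaugeExcludesTypeI_false_without_isLerayHopfOn :
    ¬ (∀ (ν T : ℝ), 0 < ν → 0 < T → ∀ (u : ℝ → (EuclideanSpace ℝ (Fin 3)) → (EuclideanSpace ℝ (Fin 3))) (p : ℝ → (EuclideanSpace ℝ (Fin 3)) → ℝ),
      IsClassicalNSSolutionOn (Set.Ico 0 T) ν 0 u p → HasRapidSpatialDecay (u 0) →
      IsTypeIBlowup u T →
      ∀ x₀ : (EuclideanSpace ℝ (Fin 3)),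
        (∃ (ρ C₀ M : ℝ) (α : ℝ → (EuclideanSpace ℝ (Fin 3)) → ℝ) (b : ℝ → (EuclideanSpace ℝ (Fin 3)) → (EuclideanSpace ℝ (Fin 3))) (d : ℝ → (EuclideanSpace ℝ (Fin 3)) → ℝ),
          0 < ρ ∧ ρ ^ 2 < T ∧
            ContDiffOn ℝ 2 (Function.uncurry α) (Set.Ioo (T - ρ ^ 2) T ×ˢ Metric.ball x₀ ρ) ∧
            (∀ t ∈ Set.Ioo (T - ρ ^ 2) T, ∀ δ ∈ Set.Ioo 0 ρ,
              MeasureTheory.volume ({x | d t x < δ} ∩ Metric.ball x₀ ρ) ≤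
                ENNReal.ofReal (C₀ * δ ^ 2 * ρ)) ∧
            (∀ t ∈ Set.Ioo (T - ρ ^ 2) T, ∀ x ∈ Metric.ball x₀ ρ, |α t x| ≤ M ∧
              inner ℝ (curl (u t) x) (gradient (α t) x) = 0 ∧
              (0 < d t x →
                ‖curl (u t) x‖ * d t x ≤ C₀ * ‖gradient (α t) x‖ ∧ ‖b t x‖ * d t x ≤ C₀ ∧
                  deriv (fun s => α s x) t + convect (u t) (α t) x =
                    ν * (Laplacian.laplacian (α t) x + inner ℝ (b t x) (gradient (α t) x))))) →
        ∃ r : ℝ, 0 < r ∧ ∃ K : ℝ, ∀ t ∈ Set.Ioo (T - r ^ 2) T, 0 ≤ t →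
          ∀ x ∈ Metric.ball x₀ r, ‖u t x‖ ≤ K) := fun h =>
  driftVel_not_bounded_near 0
    (h 1 1 one_pos one_pos driftVel driftPres (isClassical_drift 1)
      (by rw [driftVel_zero]; exact hasRapidSpatialDecay_zero) isTypeIBlowup_drift 0
      (driftVel_trivialFlatGauge 1 0))

/-- **Sanity: the crux, by name, says the drift flow is not Leray–Hopf from rest.** If `CriticalSwirlRegularity`
holds then for every `ν > 0` the drift flow `u = −log(1 − t) e₀` is NOT `IsLerayHopfOn 1 ν 0 (u 0) u` — it is a
classical solution from the rapidly decaying datum `0` with a flat swirl gauge at `(1, 0)`, yet unbounded there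
(of course it is not Leray–Hopf for the elementary reason `u(t) ∉ L²((EuclideanSpace ℝ (Fin 3)))`; the point is only that the clause is
where the crux's content enters). [folklore] -/
theorem not_isLerayHopfOn_driftVel_of_criticalSwirlRegularity
    (hCSR : Summit.NavierStokesRegularity.NavierStokesRegularity.Theses.FlatSwirlGauge.CriticalSwirlRegularity)
    {ν : ℝ} (hν : 0 < ν) : ¬ IsLerayHopfOn 1 ν 0 (driftVel 0) driftVel := fun hLH =>
  driftVel_not_bounded_near 0
    (hCSR ν 1 hν one_pos driftVel driftPres (isClassical_drift ν) hLH
      (by rw [driftVel_zero]; exact hasRapidSpatialDecay_zero) 0 (driftVel_trivialFlatGauge ν 0))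

end Summit.NavierStokesRegularity.NavierStokesRegularity.Theorems.CriticalSwirlRegularity.Negative

end
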